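import Summits.QuantumFields.YangMills.Theorems.F4SubCurvatureDoorGlobalReductionCertificate
import Summits.QuantumFields.YangMills.Theorems.F4SubCurvatureDoorMirrorAnalyticity
import HarnessLib

/-!
# LINE g17-A/g18-A «SEXTIC CHANNEL», skeleton v5 «T2′ OPENED, TOP-CHANNEL CONE CUT» — crux ⟨stmt-QuantumFields-23125⟩
# `F4SubCurvatureDoor.RationalToGeneral` (parent ⟨23035⟩ `ShortRootRigidity`; rung R2d `BalabanLadder.ROT` via `F4SubCurvatureDoor.closes`)

Seat `ym-idea-3` (D-0145 ideator, technique card «positivity / convexity»), OWNER line on route `F4SubCurvatureDoor`.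
Skeleton namespace `…Cruxes.RationalToGeneral.SexticChannel`; ONE line per crux — v5 SUPERSEDES v4 ⊃ v3 (same file slug).
v5 (2026-08-29, answer to critic idea-crit-4's SUGGESTION of 02:45Z) keeps every v4 declaration verbatim and CUTS the L-stub
`TopChannelCone` into `ChannelShellForm` (L: the distributional bookkeeping, ONE stub) + `NullConePointedness` (M, algebra) +
`ConeFatouEndgame` (M, convexity + measure theory), with `topChannelCone_of` PROVED; see the `## v5` section below.

THE WALL (tree certificate `F4SubCurvatureDoorGlobalReductionCertificate.shortRootRigidity_iff_global`, p682986) is C3 =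
«GLOBAL SHORT-ROOT RIGIDITY»: a kernel `K : ℝ⁴ → ℝ` continuous off `0`, bounded outside the unit ball, `W(B₄)`-invariant,
reflection positive across `x₀ = 0`, with the sub-curvature budget `‖x‖⁸K → 0` at `0`, invariant under the isometries of the
checkerboard lattice `D₄` (`Aut D₄ = W(F₄)`), is `O(4)`-invariant.  `InClass K` bundles exactly these six binders.

HISTORY.  v3 (g17, critic PASS 01:52Z) registered three stubs: A `MirrorAnalyticity` (class kernels are jointly real-analytic on
ℝ⁴ ∖ 0 — LANDED p687956/p688463 by `ym-line-sfw-p2-w4` g20: chamber sorting + the oblique short-root frame (e₀, ½(1,1,1,1),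
½(1,1,1,−1), ½(1,1,−1,1)) + OS continuation + Siciak; consumed below as `mirrorAnalyticity_holds`), T1″ `AnalyticFiniteType`
(THE WALL: a real-analytic class kernel has finitely many harmonic channels; kept verbatim, name + signature), and T2′
`FiniteTypeRigidity` (an SO(4)-finite class kernel is radial).  v4 OPENS T2′ INTO THREE TYPED OBLIGATIONS and proves the rest:

* `LaplaceFourier` (S1, size M/L, classical — Bochner in z⃗ ✓`bochner_holds`, Bernstein/Widder in t ✓p686604/p687025 + w4's
  `WidderLaplaceRepresentation`, and the semigroup × group assembly [BCR 1984 Ch. 4; GlimmJaffeQP1987 §6.2; Widder 1941 Ch. VI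
  Thm 21]): every class kernel is a Laplace–Fourier transform `K(t, z⃗) = ∫ e^{−Et} cos(q⃗·z⃗) dμ(E, q⃗)` (t > 0) of ONE positive
  measure `μ` on `[0,∞) × ℝ³` with `∫ e^{−tE} dμ < ∞` for every `t > 0` (μ is UV-INFINITE in general: K ~ r⁻⁸⁺).  RP + evenness
  in x₀ say exactly that (t, z⃗) ↦ K(t, z⃗) is positive definite on the *-semigroup (0,∞) × ℝ³; boundedness on t ≥ t₀ comes from
  continuity off 0 + the bound outside the unit ball.  WHY IT MIGHT FAIL: only Lean infrastructure (product assembly, vague limits).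
* `FischerNormalForm` (algebra, size S/M, classical [Axler–Bourdon–Ramey, Harmonic Function Theory, Thm 5.7; Fischer 1918]): every
  real polynomial in four variables is `Σ_m (Σᵢxᵢ²)^{e_m} · H_m` with `H_m` HARMONIC and homogeneous.  It converts the arbitrary
  polynomial channels of `FiniteType` into harmonic channels (`finiteTypeRigidity_of`, proved).  WHY IT MIGHT FAIL: it cannot
  (theorem); a small Lean debt on top of the TREE's graded Fischer decomposition
  `Literature.Algebra.Polynomial.FischerDecomposition.exists_harmonic_add_mem_span` (Goodman–Wallach Lemma 5.1.5).
* `TopChannelCone` (S2–S7, size L, THE POSITIVITY LEVER, μ given as DATA): if a class kernel with Laplace–Fourier measure μ has a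
  finite harmonic-channel expansion `K(x) = Σ_k g_k(‖x‖²) H_k(x)` off 0 (H_k harmonic homogeneous of degree d_k ≤ L, 0 < L), then
  the TOP CHANNEL `Σ_{d_k = L} g_k(‖x‖²) H_k(x)` VANISHES off 0.  PLAN (card Lines/sextic_channel.md §T2′, note T2prime_two_channel
  §§3–8): Hecke–Bochner channel form of K̂ modulo polynomials of degree ≤ 4 (S2) · every positive q⃗-smearing of μ is a thrice-
  subtracted STIELTJES transform in σ = p₀² (S3) · separation of the channel symbols by finitely many momenta + analytic continuation
  + Stieltjes inversion ⇒ supp μ ⊂ {a₀δ₀} ∪ {E ≥ |q⃗|} and the CHANNEL FORM dμ = a₀δ₀ + [Σ_{k} H_k(iE, q⃗) ρ_k(dM²)] d³q/2E with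
  signed measures ρ_k (S4) · domination along the shells q⃗ = tq̂, t → ∞ isolates the top channel: the vector measure (ρ_k)_{d_k=L}
  takes values in the cone C_L = {v : Σ v_k H_k(i,q̂) ≥ 0 on S²}, which is POINTED (a harmonic polynomial vanishing on the totally
  real slice {(i|q⃗|, q⃗)} of the null quadric is divisible by p·p, hence 0 — Fischer), so e·ρ⃗_L ≥ 0 dominates |ρ⃗_L| for e in the
  open dual cone (S5; for L = 6 the cone is [0,∞) by `sextic_shellSign` below) · Hobson + Bessel: Σ_k e_k g_k(r²) =
  ε_L(4π²)⁻¹ r^{−2L−2} ∫ k_L(Mr) d(e·ρ⃗_L), k_L(u) = u^{L+1}K_{L+1}(u) positive DECREASING, k_L(0+) = 2^L·L! (S6) · the budget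
  projects onto each channel (g_k(r²) = o(r^{−L−8})) and for L ≥ 6 MONOTONE CONVERGENCE gives (e·ρ⃗_L)([0,∞)) = 0, i.e. the top
  channel is absent (S7); for 0 < L < 6 the top channel is a W(F₄)-invariant harmonic of degree L on every sphere, and there are
  none (F₄ invariants have degrees 2, 6, 8, 12; the harmonic parts in degrees 2, 4 vanish) — this is WHERE F₄ BEATS B₄ (for W(B₄)
  the quartic channel Σxᵢ⁴ − (3/2)·… slips under the budget: Prop B `FalseWithoutF4Reflection`).  WHY IT MIGHT FAIL: the
  distributional bookkeeping of S2–S4 (K is O(r⁻⁸) at 0, so K̂ lives modulo polynomials and the Stieltjes structure must be read off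
  μ smeared in q⃗; measure-valued boundary values of the channel symbols; temperedness of ρ_k at M → 0, ∞).
PROVED HERE (sorry-free): `sextic_shellSign` (H6 ≥ 0 on forward shells), `mirrorAnalyticity_holds` (tree), `finiteType_of`,
`radial_of_harmonicExpansion` (S8: the downward induction on the top degree from `TopChannelCone`), `finiteTypeRigidity_of`
(Fischer re-indexing over Σ j, Fin M_j + the induction: `FischerNormalForm → LaplaceFourier → TopChannelCone → FiniteTypeRigidity`),
`globalRigidity_of_channels`, and the composition `RationalToGeneral_of_channels : RationalToGeneral` BY NAME through the tree
certificate `rationalToGeneral_of_global`; v5 adds `topChannelCone_of` / `topChannelCone_holds` (TopChannelCone from the three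
v5 stubs) with the helpers `laplacianLM_apply`, `isHarmonicPoly_sum_smul`, `nullEval_sum_smul`.  REGISTERED STUBS (sorried, exactly
six in v5): `stub_analyticFiniteType` (XL, wall, unchanged), `stub_laplaceFourier` (M/L), `stub_fischerNormalForm` (M),
`stub_channelShellForm` (L), `stub_nullConePointedness` (M), `stub_coneFatouEndgame` (M) — v4's `stub_topChannelCone` is now the
PROVED `topChannelCone_holds`.  LF / Fischer / NullConePointedness / ConeFatouEndgame hold unconditionally (theorems in print or
routine); ChannelShellForm and TopChannelCone are implied by C3 (radial ⇒ top channel 0 ⇒ `A = ∅`) — so the split is honest: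
T2′ ⇐ LF ∧ Fischer ∧ (CSF ∧ NCP ∧ CFE ⇒ TopChannelCone), no costume (no stub is the crux or the summit reworded; BC7 probes in the
line card: v4 3/3 CLEAN, v5 3/3 CLEAN).

BEARS ON: crux ⟨23125⟩ → ⟨23035⟩ ShortRootRigidity → route F4SubCurvatureDoor `closes` → rung R2d (ROT).  CHEAPEST FALSIFIER of the
new stubs: a two-channel kernel g(r²) + h(r²)H6(x) in the class with h ≢ 0 (it would need a positive sextic shell measure of zero
mass — none); instrument row: the refuter bounty T1pp_mu_system.md (μ-side candidates M0–M6, filters F-a…F-d).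
HONEST LABEL: support stub A is a tree theorem; T1″ (the wall), LF, Fischer, ChannelShellForm, NullConePointedness, ConeFatouEndgame
are OPEN obligations (SIZE, critic N1: given LF + Fischer, TopChannelCone ≡ T2′ — v4/v5 move no analytic content out of T2′, they
TYPE it; the analytic content of T2′ now sits in `ChannelShellForm` alone); nothing is proved
about C3, ⟨23125⟩, ⟨23035⟩, rung R2d (ROT) or the summit; the Yang–Mills mass gap is NOT proved.  No summit is proved by a line.
-/

set_option autoImplicit false

namespace Summit.QuantumFields.YangMills.Cruxes.RationalToGeneral.SexticChannel

open scoped Topology BigOperators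
open Filter Set MeasureTheory
open Literature.MathematicalPhysics.QuantumLattice (timeReflection siteToE)
open Summit.QuantumFields.YangMills.Cruxes.OSLegsAtWeakCouplingC.Sketch (IsSignedPerm)
open Summit.QuantumFields.YangMills.Theses.F4SubCurvatureDoor (ShortRootRigidity RationalToGeneral)
open Summit.QuantumFields.YangMills.Theorems.F4SubCurvatureDoorGlobalReduction (rationalToGeneral_of_global mirrorAnalyticity)

/-- Euclidean `ℝ⁴`. -/
abbrev E4 := EuclideanSpace ℝ (Fin 4)

/-- The hypotheses of C3 `GlobalShortRootRigidity`, bundled — verbatim the binders of the tree certificate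
`rationalToGeneral_of_global`: continuous off `0`, bounded outside the unit ball, `W(B₄)`-invariant, reflection positive
across `x₀ = 0`, sub-curvature budget `‖x‖⁸K → 0`, invariant under the isometries preserving `D₄`. -/
def InClass (K : E4 → ℝ) : Prop :=
  ContinuousOn K {x | x ≠ 0} ∧
  (∃ C : ℝ, ∀ x, 1 ≤ ‖x‖ → |K x| ≤ C) ∧
  (∀ R : E4 ≃ₗᵢ[ℝ] E4, IsSignedPerm R → ∀ x, K (R x) = K x) ∧
  (∀ (m : ℕ) (x : Fin m → E4) (c : Fin m → ℝ), (∀ i, 0 < x i 0) →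
      0 ≤ ∑ i, ∑ j, c i * c j * K (timeReflection 4 (x i) - x j)) ∧
  Tendsto (fun x : E4 => ‖x‖ ^ 8 * K x) (𝓝[≠] 0) (𝓝 0) ∧
  (∀ R : E4 ≃ₗᵢ[ℝ] E4,
      (∀ z : Fin 4 → ℤ, Even (∑ i, z i) → ∃ w : Fin 4 → ℤ, Even (∑ i, w i) ∧ R (siteToE z) = siteToE w) →
      ∀ x, K (R x) = K x)

/-- The sextic `W(F₄)`-invariant HARMONIC polynomial, written in the squares `uᵢ = xᵢ²`
(`= 16·(½σ₁σ₂ − 3σ₃) − σ₁³`; Laplacian zero; invariant under signed permutations and the Hadamard reflection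
`x ↦ x − ½(Σxⱼ)(1,1,1,1)`, hence under all of `W(F₄) = Aut D₄`). -/
def H6sq (u₀ u₁ u₂ u₃ : ℝ) : ℝ :=
  5 * (u₀ ^ 2 * (u₁ + u₂ + u₃) + u₁ ^ 2 * (u₀ + u₂ + u₃) + u₂ ^ 2 * (u₀ + u₁ + u₃) + u₃ ^ 2 * (u₀ + u₁ + u₂))
    - (u₀ ^ 3 + u₁ ^ 3 + u₂ ^ 3 + u₃ ^ 3)
    - 30 * (u₀ * u₁ * u₂ + u₀ * u₁ * u₃ + u₀ * u₂ * u₃ + u₁ * u₂ * u₃)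

/-- `H6` on `ℝ⁴`: the generator of the unique sextic `W(F₄)`-harmonic channel. -/
def H6 (x : E4) : ℝ := H6sq (x 0 ^ 2) (x 1 ^ 2) (x 2 ^ 2) (x 3 ^ 2)

/-! ## The shell-sign lemma (PROVED): the sextic multiplier is `≥ 0` on every forward mass shell

Momentum convention `u = (p₀², q₁², q₂², q₃²)` at `p₀ = iE`, `E² = |q⃗|² + μ`, `μ = M² ≥ 0`:
`u₀ = −(a + b + c + μ)` with `a, b, c = qₖ² ≥ 0`. -/

theorem shellSign_identity (a b c μ : ℝ) :
    H6sq (-(a + b + c + μ)) a b c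
      = μ ^ 3 + 8 * μ ^ 2 * (a + b + c) + 8 * μ * (a + b + c) ^ 2 + 40 * μ * (a * b + b * c + c * a)
        + 48 * (a ^ 2 * b + a ^ 2 * c + a * b ^ 2 + b ^ 2 * c + a * c ^ 2 + b * c ^ 2 + 2 * (a * b * c)) := by
  unfold H6sq; ring

/-- **Shell sign of the sextic.** On every forward shell the `W(F₄)` sextic harmonic is non-negative (indeed `> 0` off
`q⃗ = 0, μ = 0`) and grows like `|q⃗|⁶` along the shell — the input of T2's domination argument. [folklore] -/
theorem sextic_shellSign (a b c μ : ℝ) (ha : 0 ≤ a) (hb : 0 ≤ b) (hc : 0 ≤ c) (hμ : 0 ≤ μ) :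
    0 ≤ H6sq (-(a + b + c + μ)) a b c := by
  rw [shellSign_identity]
  positivity

/-! ## The obligations (registered stubs: v3 = A · T1'' · T2')

History: v1 (01:04Z) TwoChannel/SexticExclusion → v2 (01:15Z) FiniteType/FiniteTypeRigidity → v3 (this file):
  C3 ⟸ FiniteType ∧ FiniteTypeRigidity,   FiniteType ⟸ MirrorAnalyticity ∧ AnalyticFiniteType  (both arrows proved below),
where FiniteType says a class kernel is SO(4)-FINITE off the origin — a finite sum of (radial function) × (polynomial),
i.e. finitely many harmonic channels — and FiniteTypeRigidity says an SO(4)-finite class kernel is radial.  All three stubs are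
consequences of C3; A (`MirrorAnalyticity`) is moreover believed provable OUTRIGHT (it does not use the budget).
FiniteTypeRigidity has a paper proof plan S1–S8 (module docstring / card §T2'-v3).  AnalyticFiniteType is THE WALL; its
independent mechanism is growth on complex quadric fibres («quadric Liouville»: fibre growth o(|z|^N) ⇒ only channels ℓ < N),
now legitimately posed on real-analytic kernels (stub A supplies the complexification near the reals). -/

/-- Stub A «MIRROR ANALYTICITY» (M/L; provable with tree tools — see the module docstring: 24-cell spanning property +
`IsMirrorRPKernel.exists_halfPlane_continuation` across the 12 short-root mirrors + Siciak's cross theorem in a non-orthogonal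
short-root basis + `analyticAt_of_holomorphic_chart_fintype`).  Every kernel of the C3 class is jointly real-analytic at every
x ≠ 0 (the g16 theorem `jointAnalyticityOffMirrors` gives this only off the coordinate mirrors; the F₄ mirrors remove the blind
points).  Uses continuity off 0, the bound outside the unit ball, W(F₄)-invariance and RP — NOT the budget.  WHY IT MIGHT FAIL:
only in bookkeeping (uniform slab bounds along oblique slices; the margin min_j |⟪x,u_j⟫|/10 for the parallelepiped cross). -/
def MirrorAnalyticity : Prop :=
  ∀ K : E4 → ℝ, InClass K → ∀ x : E4, x ≠ 0 → AnalyticAt ℝ K x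

/-- The v2 obligation T1' «FINITE SO(4)-TYPE», now DERIVED (`finiteType_of`) from A and T1''.  Every kernel of the C3 class
is, off the origin, a finite sum of radial functions times polynomials (finitely many spherical-harmonic channels).  Implied
by C3. -/
def FiniteType : Prop :=
  ∀ K : E4 → ℝ, InClass K →
    ∃ (N : ℕ) (P : Fin N → MvPolynomial (Fin 4) ℝ) (g : Fin N → ℝ → ℝ),
      ∀ x : E4, x ≠ 0 → K x = ∑ j, g j (‖x‖ ^ 2) * MvPolynomial.eval (fun i => x i) (P j)

/-- T1'' «ANALYTIC FINITE TYPE» (XL, the hardest stub = the residual wall).  A REAL-ANALYTIC (on ℝ⁴ ∖ 0) kernel of the C3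
class has finitely many harmonic channels.  Implied by C3 (radial ⇒ one channel).  MECHANISM (independent of radiality): the
12 mirror half-plane continuations + W(F₄) + the real budget should bound the growth of the complexification along the complex
quadric fibres {z·z = w} by o(|z|⁸), and a W(F₄)-invariant holomorphic function of fibre growth < N on an affine quadric has only
channels of degree < N («quadric Liouville»).  On the Laplace–Fourier side the target is the exclusion of an infinite,
jointly shell-positive family of signed channel measures whose leading UV terms resum (non-termwise asymptotics) — the one
loophole the T2' argument leaves; analyticity across all 12 mirrors adds the arithmetic constraints «every odd E-moment of μ
across each mirror is a polynomial density» (card §T1''-v3).  WHY IT MIGHT FAIL: such a conspiracy exists — then C3 is false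
and ⟨23125⟩ with it (the door closes; record it as a negative). -/
def AnalyticFiniteType : Prop :=
  ∀ K : E4 → ℝ, InClass K → (∀ x : E4, x ≠ 0 → AnalyticAt ℝ K x) →
    ∃ (N : ℕ) (P : Fin N → MvPolynomial (Fin 4) ℝ) (g : Fin N → ℝ → ℝ),
      ∀ x : E4, x ≠ 0 → K x = ∑ j, g j (‖x‖ ^ 2) * MvPolynomial.eval (fun i => x i) (P j)

/-- T2' «FINITE-TYPE RIGIDITY» (L; plan S1–S8 in the module docstring — two facts carry it: the budget passes to each channel
separately (angular projection on spheres), and the top channel's shell measure takes values in a POINTED cone, so budget +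
Fatou kill its total mass): an SO(4)-finite kernel of the C3 class is radial off the origin.  Subsumes v1's `SexticExclusion`
(channel set {0, 6}); strictly contains the parent crux's recorded risk («log-dressed ℓ = 6 component»: arbitrary radial
dressings are allowed here, the momentum-rational class of ⟨23124⟩ is not assumed).  WHY IT MIGHT FAIL: only in the
distributional bookkeeping of S2–S4 — `K` is not integrable at `0` (O(‖x‖⁻⁸)), so the channel symbols are tempered
distributions modulo polynomials and the Stieltjes structure must be read off the Laplace–Fourier measure of RP (smeared in q⃗),
not from `K̂` pointwise. -/
def FiniteTypeRigidity : Prop :=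
  ∀ K : E4 → ℝ, InClass K →
    ∀ (N : ℕ) (P : Fin N → MvPolynomial (Fin 4) ℝ) (g : Fin N → ℝ → ℝ),
      (∀ x : E4, x ≠ 0 → K x = ∑ j, g j (‖x‖ ^ 2) * MvPolynomial.eval (fun i => x i) (P j)) →
      ∃ g₀ : ℝ → ℝ, ∀ x : E4, x ≠ 0 → K x = g₀ (‖x‖ ^ 2)

/-- Stub A is now a TREE THEOREM (p687956, `F4SubCurvatureDoorGlobalReduction.mirrorAnalyticity`, seat `ym-line-sfw-p2-w4`
g20; the by-name form `F4SubCurvatureDoorMirrorAnalyticityRegistered.stub_mirrorAnalyticity` landed p688463).  The budget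
conjunct of `InClass` is not used. -/
theorem mirrorAnalyticity_holds : MirrorAnalyticity := by
  intro K hK x hx
  obtain ⟨h1, h2, h3, h4, -, h6⟩ := hK
  exact mirrorAnalyticity K h1 h2 h3 h4 h6 x hx

theorem stub_analyticFiniteType : AnalyticFiniteType := by
  sorry

/-- v2's T1' from the pair (A, T1''): pure logic (A is now a theorem). -/
theorem finiteType_of (hA : MirrorAnalyticity) (hT : AnalyticFiniteType) : FiniteType :=
  fun K hK => hT K hK (hA K hK)

/-! ## v4: T2′ `FiniteTypeRigidity` OPENED — Laplace–Fourier measure · Fischer normal form · top-channel cone -/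

/-- Euclidean `ℝ³` (space). -/
abbrev E3 := EuclideanSpace ℝ (Fin 3)

/-- The point `(t, z⃗) ∈ ℝ⁴`: time coordinate `t = x₀`, space coordinates `z⃗ = (x₁, x₂, x₃)`. -/
noncomputable def timeSpace (t : ℝ) (z : E3) : E4 :=
  (WithLp.equiv 2 (Fin 4 → ℝ)).symm (Fin.cons t (fun j => z j))

@[simp] theorem timeSpace_zero (t : ℝ) (z : E3) : timeSpace t z 0 = t := by
  simp [timeSpace]

@[simp] theorem timeSpace_succ (t : ℝ) (z : E3) (j : Fin 3) : timeSpace t z j.succ = z j := by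
  simp [timeSpace]

/-- `μ` is a LAPLACE–FOURIER MEASURE of `K`: a positive measure on `ℝ × ℝ³` carried by `E ≥ 0`, with `∫ e^{−tE} dμ < ∞` for
every `t > 0`, representing `K` on the open half-space `x₀ > 0` as `K(t, z⃗) = ∫ e^{−tE} cos(q⃗·z⃗) dμ(E, q⃗)`. -/
def IsLF (K : E4 → ℝ) (μ : Measure (ℝ × E3)) : Prop :=
  μ (Set.Iio 0 ×ˢ Set.univ) = 0 ∧
  (∀ t : ℝ, 0 < t → Integrable (fun p : ℝ × E3 => Real.exp (-(t * p.1))) μ) ∧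
  ∀ (t : ℝ) (z : E3), 0 < t →
    K (timeSpace t z) = ∫ p : ℝ × E3, Real.exp (-(t * p.1)) * Real.cos (inner ℝ p.2 z) ∂μ

/-- Stub S1 «LAPLACE–FOURIER MEASURE OF RP» (M/L, classical): every kernel of the C3 class has a Laplace–Fourier measure.
Reflection positivity in Gram form + evenness in `x₀` (from `W(B₄)`) = positive-definiteness of `(t, z⃗) ↦ K(t, z⃗)` on the
*-semigroup `(0,∞) × ℝ³` with involution `(t, z⃗)* = (t, −z⃗)`; continuity off `0` and the bound outside the unit ball make
`K` bounded and continuous on every closed slab `t ≥ t₀ > 0`; Bochner in `z⃗` (tree `bochner_holds`), Bernstein–Widder in `t`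
(tree p686604 / p687025; Widder Ch. VI Thm 21 for the semigroup form) and the product assembly give ONE `μ` [BCR 1984, Thm 4.2.8
with bounded semicharacters `e^{−Et}e^{iq⃗·z⃗}`; GlimmJaffeQP1987 §6.2].  `E < 0` is excluded by boundedness on `t ≥ 1`;
`∫ e^{−tE} dμ = K(t, 0) < ∞`.  WHY IT MIGHT FAIL: Lean infrastructure only (vague limits / consistency of the slab measures). -/
def LaplaceFourier : Prop :=
  ∀ K : E4 → ℝ, InClass K → ∃ μ : Measure (ℝ × E3), IsLF K μ

/-- The polynomial Laplacian `Δ = Σᵢ ∂ᵢ²` on `ℝ[x₀, x₁, x₂, x₃]`. -/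
noncomputable def laplacian (P : MvPolynomial (Fin 4) ℝ) : MvPolynomial (Fin 4) ℝ :=
  ∑ i : Fin 4, MvPolynomial.pderiv i (MvPolynomial.pderiv i P)

/-- `P` is a harmonic polynomial: `ΔP = 0`. -/
def IsHarmonicPoly (P : MvPolynomial (Fin 4) ℝ) : Prop :=
  laplacian P = 0

/-- `r² = Σᵢ xᵢ²` as a polynomial. -/
noncomputable def r2poly : MvPolynomial (Fin 4) ℝ :=
  ∑ i : Fin 4, MvPolynomial.X i ^ 2

theorem eval_r2poly (x : E4) : MvPolynomial.eval (fun i => x i) r2poly = ‖x‖ ^ 2 := by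
  rw [EuclideanSpace.real_norm_sq_eq]
  simp [r2poly, map_sum, map_pow]

theorem isHarmonicPoly_one : IsHarmonicPoly 1 := by
  simp [IsHarmonicPoly, laplacian]

/-- Stub «FISCHER NORMAL FORM» (S/M, classical [Axler–Bourdon–Ramey, Harmonic Function Theory, Thm 5.7; GoodmanWallachGTM255
Lemma 5.1.5]): every real polynomial in four variables is a finite sum `Σ_m (r²)^{e_m} · H_m` with `H_m` harmonic and homogeneous
(of degree `d_m`).  A theorem; the obligation is its formalisation — CHEAPEST FIRST TARGET of v4: the TREE already has the graded
Fischer decomposition `Literature.Algebra.Polynomial.FischerDecomposition.exists_harmonic_add_mem_span` (take `S = {Σᵢ Xᵢ²}` and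
`D` = the `pderiv` algebra homomorphism of `exists_algHom_pderiv`, so that `D r2poly h = laplacian h`); what remains is
`homogeneousComponent` bookkeeping, `Ideal.mem_span_singleton` (q = r²·c with c homogeneous of degree k − 2) and induction on the
degree.  Mathlib itself has no harmonic polynomials.  WHY IT MIGHT FAIL: it cannot. -/
def FischerNormalForm : Prop :=
  ∀ P : MvPolynomial (Fin 4) ℝ,
    ∃ (M : ℕ) (H : Fin M → MvPolynomial (Fin 4) ℝ) (d e : Fin M → ℕ),
      (∀ m, (H m).IsHomogeneous (d m)) ∧ (∀ m, IsHarmonicPoly (H m)) ∧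
      P = ∑ m, r2poly ^ (e m) * H m

/-- Stub «TOP-CHANNEL CONE» (L; S2–S7 of the T2′ plan, THE POSITIVITY LEVER; the Laplace–Fourier measure is DATA here): for a
class kernel `K` with Laplace–Fourier measure `μ` and a finite HARMONIC channel expansion off the origin,
`K(x) = Σ_k g_k(‖x‖²) H_k(x)` with `H_k` harmonic homogeneous of degree `d_k ≤ L`, `0 < L`, the top channel
`Σ_{d_k = L} g_k(‖x‖²) H_k(x)` vanishes off the origin.  Mechanism: channel form of `μ` on the forward shells with signed shell
measures `ρ_k`; along `q⃗ = tq̂, t → ∞` the top channel dominates, so `(ρ_k)_{d_k = L}` is valued in a POINTED cone (identity theorem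
on the totally real slice of the null quadric + Fischer), a strictly positive functional `e·ρ⃗_L ≥ 0` controls `|ρ⃗_L|`; Hobson +
Bessel `Σ e_k g_k(r²) = ε r^{−2L−2} ∫ (Mr)^{L+1} K_{L+1}(Mr) d(e·ρ⃗_L)` with `u^{L+1}K_{L+1}(u)` positive decreasing, and the
channel budget `g_k(r²) = o(r^{−L−8})` + monotone convergence force `e·ρ⃗_L = 0` for `L ≥ 6`; for `0 < L < 6` the top channel is a
`W(F₄)`-invariant harmonic of degree `L` on each sphere, and there is none.  Implied by C3 (radial ⇒ every positive-degree
isotypic component is `0`).  WHY IT MIGHT FAIL: the distributional bookkeeping (K̂ modulo polynomials of degree ≤ 4; Stieltjes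
structure read off `μ` smeared in `q⃗`; measure-valued boundary values; temperedness of `ρ_k` at `M → 0, ∞`). -/
def TopChannelCone : Prop :=
  ∀ K : E4 → ℝ, InClass K → ∀ μ : Measure (ℝ × E3), IsLF K μ →
    ∀ (ι : Type) [Fintype ι] (H : ι → MvPolynomial (Fin 4) ℝ) (d : ι → ℕ) (g : ι → ℝ → ℝ),
      (∀ k, (H k).IsHomogeneous (d k)) → (∀ k, IsHarmonicPoly (H k)) →
      (∀ x : E4, x ≠ 0 → K x = ∑ k, g k (‖x‖ ^ 2) * MvPolynomial.eval (fun i => x i) (H k)) →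
      ∀ L : ℕ, 0 < L → (∀ k, d k ≤ L) →
      ∀ x : E4, x ≠ 0 →
        ∑ k ∈ Finset.univ.filter (fun k => d k = L), g k (‖x‖ ^ 2) * MvPolynomial.eval (fun i => x i) (H k) = 0

theorem stub_laplaceFourier : LaplaceFourier := by
  sorry

theorem stub_fischerNormalForm : FischerNormalForm := by
  sorry

/-! ## v5 (critic SUGGESTION 2026-08-29T02:45Z): `TopChannelCone` CUT into channel shell form · null-cone pointedness ·
cone–Fatou endgame, with the composition `topChannelCone_of` PROVED.  Fatou/dominated convergence on `[0,N]` replaces the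
monotonicity of `u^ν K_ν(u)`; the special function enters only through an abstract profile `φ ≥ 0`, continuous at `0⁺`,
`φ(0) > 0` (instance: `φ(u) = u^{L+1} K_{L+1}(u)`, `φ(0) = 2^L·L!`, DLMF 10.31.1). -/

/-- Complex evaluation of a real polynomial on `ℝ⁴` at the forward null momentum `(i‖q⃗‖, q⃗)` (`p·p = 0`). -/
noncomputable def nullEval (P : MvPolynomial (Fin 4) ℝ) (q : E3) : ℂ :=
  MvPolynomial.aeval (Fin.cons (Complex.I * (‖q‖ : ℂ)) (fun j : Fin 3 => ((q j : ℝ) : ℂ))) P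

/-- The Laplacian on `MvPolynomial (Fin 4) ℝ` as a linear map (bookkeeping for `laplacian`). -/
noncomputable def laplacianLM : MvPolynomial (Fin 4) ℝ →ₗ[ℝ] MvPolynomial (Fin 4) ℝ :=
  ∑ i : Fin 4, (MvPolynomial.pderiv i).toLinearMap ∘ₗ (MvPolynomial.pderiv i).toLinearMap

theorem laplacianLM_apply (P : MvPolynomial (Fin 4) ℝ) : laplacianLM P = laplacian P := by
  simp [laplacianLM, laplacian, LinearMap.sum_apply]

theorem isHarmonicPoly_sum_smul {A : Type} [Fintype A] (v : A → ℝ) (P : A → MvPolynomial (Fin 4) ℝ)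
    (h : ∀ a, IsHarmonicPoly (P a)) : IsHarmonicPoly (∑ a, v a • P a) := by
  unfold IsHarmonicPoly at h ⊢
  rw [← laplacianLM_apply, map_sum]
  refine Finset.sum_eq_zero (fun a _ => ?_)
  rw [map_smul, laplacianLM_apply, h a, smul_zero]

theorem nullEval_sum_smul {A : Type} [Fintype A] (v : A → ℝ) (P : A → MvPolynomial (Fin 4) ℝ) (q : E3) :
    nullEval (∑ a, v a • P a) q = ∑ a, (v a : ℂ) * nullEval (P a) q := by
  unfold nullEval
  rw [map_sum]
  refine Finset.sum_congr rfl (fun a _ => ?_)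
  rw [map_smul, Complex.real_smul]

/-- Stub «NULL-CONE POINTEDNESS» (M, algebra; S5 of the plan): a real harmonic homogeneous polynomial on `ℝ⁴` that vanishes at
every forward null momentum `(i‖q⃗‖, q⃗)`, `q⃗ ∈ ℝ³`, is zero.  Proof route: split `P = P_e(p₀², q⃗) + p₀·P_o(p₀², q⃗)`; vanishing
gives `P_e(−|q⃗|², q⃗) = P_o(−|q⃗|², q⃗) = 0` on `ℝ³`, hence `p·p ∣ P`, and a harmonic multiple of `p·p` is `0` (Fischer; tree
`Literature.Algebra.Polynomial.FischerDecomposition`).  It makes the top-channel cone POINTED.  WHY IT MIGHT FAIL: it does not —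
a theorem; Lean cost = polynomial division by `X₀² + Σⱼ Xⱼ²` and the uniqueness half of Fischer. -/
def NullConePointedness : Prop :=
  ∀ (L : ℕ) (P : MvPolynomial (Fin 4) ℝ), P.IsHomogeneous L → IsHarmonicPoly P →
    (∀ q : E3, nullEval P q = 0) → P = 0

/-- Stub «CONE–FATOU ENDGAME» (M, finite-dimensional convexity + measure theory; the positivity endgame S5-dual-cone + S7 of the
plan): a finite family of signed measures `ρ⁺_a − ρ⁻_a` on `[0,∞)` whose increments on bounded sets lie in the POINTED closed convex
cone `{v : Σ_a v_a N_a(q⃗) ≥ 0 ∀ q⃗}` and whose `φ`-transforms all tend to `0` as `r → 0⁺` (`φ ≥ 0` measurable, continuous at `0`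
from the right, `φ(0) > 0`) is ZERO: a strictly positive functional `e` on the pointed cone (`e·v ≥ c|v|`) makes
`σ := Σ_a e_a(ρ⁺_a − ρ⁻_a)` non-negative on bounded sets, `∫ φ(Mr) dσ(M) → 0`, while `∫ φ(Mr) dσ ≥ ∫_{[0,N]} φ(Mr) dσ → φ(0)·σ[0,N]`
(dominated convergence on the finite positive measure `σ|[0,N]`); so `σ[0,N] = 0`, `e·v(S) = 0`, `v(S) = 0` on bounded `S`.
WHY IT MIGHT FAIL: it does not — a theorem; Lean cost = the strictly positive functional on a pointed closed convex cone in `ℝ^A`. -/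
def ConeFatouEndgame : Prop :=
  ∀ (φ : ℝ → ℝ), Measurable φ → (∀ u, 0 ≤ φ u) → ContinuousWithinAt φ (Set.Ici 0) 0 → 0 < φ 0 →
  ∀ (A : Type) [Fintype A] (N : A → E3 → ℝ) (ρp ρm : A → Measure ℝ),
    (∀ a, IsLocallyFiniteMeasure (ρp a) ∧ IsLocallyFiniteMeasure (ρm a)) →
    (∀ a, (ρp a) (Set.Iio 0) = 0 ∧ (ρm a) (Set.Iio 0) = 0) →
    (∀ v : A → ℝ, (∀ q : E3, ∑ a, v a * N a q = 0) → v = 0) →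
    (∀ S : Set ℝ, MeasurableSet S → Bornology.IsBounded S →
        ∀ q : E3, 0 ≤ ∑ a, (((ρp a) S).toReal - ((ρm a) S).toReal) * N a q) →
    (∀ a (r : ℝ), 0 < r → Integrable (fun M => φ (M * r)) (ρp a) ∧ Integrable (fun M => φ (M * r)) (ρm a)) →
    (∀ a, Tendsto (fun r : ℝ => (∫ M, φ (M * r) ∂(ρp a)) - ∫ M, φ (M * r) ∂(ρm a)) (𝓝[>] 0) (𝓝 0)) →
    ∀ a, ρp a = ρm a

/-- Stub «CHANNEL SHELL FORM» (L; S2–S4 + S6 of the plan, the channelwise budget, and invariant theory for `0 < L < 6` — the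
distributional bookkeeping isolated in ONE stub): for a class kernel `K` with Laplace–Fourier measure `μ` and a finite harmonic
channel expansion with top degree `L > 0`, the top channel is a HOBSON–BESSEL TRANSFORM of cone-valued shell measures: there are a
profile `φ` (instance `u^{L+1}K_{L+1}(u)`, `φ(0) = 2^L·L!`), finitely many real harmonic homogeneous degree-`L` polynomials `H̃_a`,
linearly independent and REAL at the forward null momenta (choose them even in `p₀`: the top channel of a class kernel is
`W(B₄)`-invariant), locally finite measures `ρ⁺_a, ρ⁻_a` on `[0,∞)` (Jordan parts of the signed top-channel shell measures, read off
`μ` by Stieltjes inversion of the `q⃗`-disintegrated slices, §4(c)–(f)) and a scalar prefactor `C(r)` (instance `± (4π²)⁻¹ r^{−2L−2}`)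
with: (R) `Σ_{d_k = L} g_k(‖x‖²) H_k(x) = C(‖x‖)·Σ_a H̃_a(x)·∫ φ(M‖x‖) d(ρ⁺_a − ρ⁻_a)(M)` off the origin; (P) shell positivity of `μ`
in the top-degree-dominated limit `q⃗ = tq̂, t → ∞` (§5): the increments of `(ρ⁺_a − ρ⁻_a)_a` on bounded sets lie in the cone
`{v : Σ_a v_a H̃_a(i‖q⃗‖, q⃗) ≥ 0 ∀ q⃗}`; (B) the channelwise budget `∫ φ(Mr) d(ρ⁺_a − ρ⁻_a) → 0` as `r → 0⁺` (`= o(r^{L−6})`,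
`L ≥ 6`, from `‖x‖⁸K → 0` projected on `𝓗_L`).  For `0 < L < 6` (and every `L ∉ 6ℕ+8ℕ+12ℕ`) the top channel is a `W(F₄)`-invariant
harmonic of degree `L`, hence `0`, and `A = ∅` does it.  Implied by C3 (radial ⇒ top channel `0` ⇒ `A = ∅`).  WHY IT MIGHT FAIL: the
bookkeeping named in v4 — `K̂` modulo polynomials of degree ≤ 4, measure-valued boundary values (①′), local finiteness of `ρ_a` at
`M → 0` (②), Hecke–Bochner for distributions (③). -/
def ChannelShellForm : Prop :=
  ∀ K : E4 → ℝ, InClass K → ∀ μ : Measure (ℝ × E3), IsLF K μ →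
    ∀ (ι : Type) [Fintype ι] (H : ι → MvPolynomial (Fin 4) ℝ) (d : ι → ℕ) (g : ι → ℝ → ℝ),
      (∀ k, (H k).IsHomogeneous (d k)) → (∀ k, IsHarmonicPoly (H k)) →
      (∀ x : E4, x ≠ 0 → K x = ∑ k, g k (‖x‖ ^ 2) * MvPolynomial.eval (fun i => x i) (H k)) →
      ∀ L : ℕ, 0 < L → (∀ k, d k ≤ L) →
      ∃ (φ : ℝ → ℝ) (A : Type) (_ : Fintype A) (Ht : A → MvPolynomial (Fin 4) ℝ) (ρp ρm : A → Measure ℝ) (C : ℝ → ℝ),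
        Measurable φ ∧ (∀ u, 0 ≤ φ u) ∧ ContinuousWithinAt φ (Set.Ici 0) 0 ∧ 0 < φ 0 ∧
        (∀ a, (Ht a).IsHomogeneous L) ∧ (∀ a, IsHarmonicPoly (Ht a)) ∧ LinearIndependent ℝ Ht ∧
        (∀ a (q : E3), (nullEval (Ht a) q).im = 0) ∧
        (∀ a, IsLocallyFiniteMeasure (ρp a) ∧ IsLocallyFiniteMeasure (ρm a)) ∧
        (∀ a, (ρp a) (Set.Iio 0) = 0 ∧ (ρm a) (Set.Iio 0) = 0) ∧
        (∀ S : Set ℝ, MeasurableSet S → Bornology.IsBounded S →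
            ∀ q : E3, 0 ≤ ∑ a, (((ρp a) S).toReal - ((ρm a) S).toReal) * (nullEval (Ht a) q).re) ∧
        (∀ a (r : ℝ), 0 < r → Integrable (fun M => φ (M * r)) (ρp a) ∧ Integrable (fun M => φ (M * r)) (ρm a)) ∧
        (∀ a, Tendsto (fun r : ℝ => (∫ M, φ (M * r) ∂(ρp a)) - ∫ M, φ (M * r) ∂(ρm a)) (𝓝[>] 0) (𝓝 0)) ∧
        (∀ x : E4, x ≠ 0 →
          ∑ k ∈ Finset.univ.filter (fun k => d k = L), g k (‖x‖ ^ 2) * MvPolynomial.eval (fun i => x i) (H k)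
            = C ‖x‖ * ∑ a, MvPolynomial.eval (fun i => x i) (Ht a) *
                ((∫ M, φ (M * ‖x‖) ∂(ρp a)) - ∫ M, φ (M * ‖x‖) ∂(ρm a)))

theorem stub_channelShellForm : ChannelShellForm := by
  sorry

theorem stub_nullConePointedness : NullConePointedness := by
  sorry

theorem stub_coneFatouEndgame : ConeFatouEndgame := by
  sorry

/-- **v5 COMPOSITION (proved)**: channel shell form + null-cone pointedness + cone–Fatou endgame ⇒ the v4 top-channel cone. -/
theorem topChannelCone_of (hN : NullConePointedness) (hCF : ChannelShellForm) (hE : ConeFatouEndgame) :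
    TopChannelCone := by
  intro K hK μ hμ ι _ H d g hH hharm hexp L hL hd x hx
  obtain ⟨φ, A, _, Ht, ρp, ρm, C, hφm, hφ0, hφc, hφpos, hHtL, hHth, hLI, hreal, hlf, hsupp, hcone, hint, hbud, hR⟩ :=
    hCF K hK μ hμ ι H d g hH hharm hexp L hL hd
  -- the null-evaluation cone is pointed (hN + linear independence)
  have hpt : ∀ v : A → ℝ, (∀ q : E3, ∑ a, v a * (nullEval (Ht a) q).re = 0) → v = 0 := by
    intro v hv
    have hP0 : ∑ a, v a • Ht a = 0 := by
      refine hN L _ ?_ (isHarmonicPoly_sum_smul v Ht hHth) ?_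
      · refine MvPolynomial.IsHomogeneous.sum _ _ _ (fun a _ => ?_)
        rw [MvPolynomial.smul_eq_C_mul]
        simpa using (MvPolynomial.isHomogeneous_C (Fin 4) (v a)).mul (hHtL a)
      · intro q
        rw [nullEval_sum_smul]
        apply Complex.ext
        · rw [Complex.re_sum, Complex.zero_re]
          simpa [Complex.re_ofReal_mul] using hv q
        · rw [Complex.im_sum, Complex.zero_im]
          refine Finset.sum_eq_zero (fun a _ => ?_)
          rw [Complex.im_ofReal_mul, hreal a q, mul_zero]
    funext a
    exact (Fintype.linearIndependent_iff.mp hLI v hP0) a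
  have hz : ∀ a, ρp a = ρm a :=
    hE φ hφm hφ0 hφc hφpos A (fun a q => (nullEval (Ht a) q).re) ρp ρm hlf hsupp hpt hcone hint hbud
  rw [hR x hx]
  simp [hz]

/-- The v4 stub `TopChannelCone`, now a consequence of the three v5 stubs. -/
theorem topChannelCone_holds : TopChannelCone :=
  topChannelCone_of stub_nullConePointedness stub_channelShellForm stub_coneFatouEndgame

/-- S8 «DOWNWARD INDUCTION ON THE TOP DEGREE» (proved): with the top-channel cone, a class kernel with a Laplace–Fourier measure
and a finite harmonic channel expansion is radial off the origin. -/
theorem radial_of_harmonicExpansion (hT : TopChannelCone) (K : E4 → ℝ) (hK : InClass K) (μ : Measure (ℝ × E3))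
    (hμ : IsLF K μ) :
    ∀ (L : ℕ) (ι : Type) [Fintype ι] (H : ι → MvPolynomial (Fin 4) ℝ) (d : ι → ℕ) (g : ι → ℝ → ℝ),
      (∀ k, (H k).IsHomogeneous (d k)) → (∀ k, IsHarmonicPoly (H k)) → (∀ k, d k ≤ L) →
      (∀ x : E4, x ≠ 0 → K x = ∑ k, g k (‖x‖ ^ 2) * MvPolynomial.eval (fun i => x i) (H k)) →
      ∃ g₀ : ℝ → ℝ, ∀ x : E4, x ≠ 0 → K x = g₀ (‖x‖ ^ 2) := by
  intro L
  induction L with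
  | zero =>
    intro ι _ H d g hhom _ hdeg hrep
    refine ⟨fun s => ∑ k, g k s * MvPolynomial.coeff 0 (H k), fun x hx => ?_⟩
    rw [hrep x hx]
    refine Finset.sum_congr rfl fun k _ => ?_
    have h0 : (H k).IsHomogeneous 0 := by
      have hk : d k = 0 := Nat.le_zero.mp (hdeg k)
      simpa [hk] using hhom k
    have hC : H k = MvPolynomial.C (MvPolynomial.coeff 0 (H k)) :=
      MvPolynomial.totalDegree_eq_zero_iff_eq_C.mp
        ((MvPolynomial.totalDegree_zero_iff_isHomogeneous (Fin 4)).mpr h0)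
    calc g k (‖x‖ ^ 2) * MvPolynomial.eval (fun i => x i) (H k)
        = g k (‖x‖ ^ 2) * MvPolynomial.eval (fun i => x i) (MvPolynomial.C (MvPolynomial.coeff 0 (H k))) := by
          rw [← hC]
      _ = g k (‖x‖ ^ 2) * MvPolynomial.coeff 0 (H k) := by rw [MvPolynomial.eval_C]
  | succ L ih =>
    intro ι _ H d g hhom hharm hdeg hrep
    classical
    have htop := hT K hK μ hμ ι H d g hhom hharm hrep (L + 1) (Nat.succ_pos L) hdeg
    -- drop the top channel: replace its members by the zero profile on the constant harmonic `1`
    let g' : ι → ℝ → ℝ := fun k => if d k = L + 1 then (fun _ => 0) else g k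
    let H' : ι → MvPolynomial (Fin 4) ℝ := fun k => if d k = L + 1 then 1 else H k
    let d' : ι → ℕ := fun k => if d k = L + 1 then 0 else d k
    refine ih ι H' d' g' ?_ ?_ ?_ ?_
    · intro k
      by_cases hk : d k = L + 1
      · simpa [H', d', hk] using MvPolynomial.isHomogeneous_one (Fin 4) ℝ
      · simpa [H', d', hk] using hhom k
    · intro k
      by_cases hk : d k = L + 1
      · simpa [H', hk] using isHarmonicPoly_one
      · simpa [H', hk] using hharm k
    · intro k
      by_cases hk : d k = L + 1
      · simp [d', hk]
      · have := hdeg k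
        simp only [d', hk, if_false]
        omega
    · intro x hx
      rw [hrep x hx, ← Finset.sum_filter_add_sum_filter_not Finset.univ (fun k => d k = L + 1), htop x hx, zero_add,
        ← Finset.sum_filter_add_sum_filter_not Finset.univ (fun k => d k = L + 1) (fun k => g' k _ * _)]
      have h1 : ∑ k ∈ Finset.univ.filter (fun k => d k = L + 1),
          g' k (‖x‖ ^ 2) * MvPolynomial.eval (fun i => x i) (H' k) = 0 := by
        refine Finset.sum_eq_zero fun k hk => ?_
        rw [Finset.mem_filter] at hk
        simp [g', hk.2]
      rw [h1, zero_add]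
      refine Finset.sum_congr rfl fun k hk => ?_
      rw [Finset.mem_filter] at hk
      simp [g', H', hk.2]

/-- **T2′ from the three v4 obligations** (proved): Fischer normal form of the polynomial channels, re-indexing over
`Σ j, Fin M_j`, then `radial_of_harmonicExpansion`. -/
theorem finiteTypeRigidity_of (hF : FischerNormalForm) (hLF : LaplaceFourier) (hT : TopChannelCone) :
    FiniteTypeRigidity := by
  intro K hK N P g hrep
  obtain ⟨μ, hμ⟩ := hLF K hK
  classical
  choose M H d e hhom hharm hP using hF
  let ι := Σ j : Fin N, Fin (M (P j))
  let H' : ι → MvPolynomial (Fin 4) ℝ := fun km => H (P km.1) km.2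
  let d' : ι → ℕ := fun km => d (P km.1) km.2
  let g' : ι → ℝ → ℝ := fun km s => g km.1 s * s ^ (e (P km.1) km.2)
  have hL : ∀ km : ι, d' km ≤ Finset.univ.sup d' := fun km => Finset.le_sup (Finset.mem_univ km)
  refine radial_of_harmonicExpansion hT K hK μ hμ (Finset.univ.sup d') ι H' d' g' (fun km => hhom _ _)
    (fun km => hharm _ _) hL ?_
  intro x hx
  rw [hrep x hx]
  have hsig : ∑ km : ι, g' km (‖x‖ ^ 2) * MvPolynomial.eval (fun i => x i) (H' km)
      = ∑ j : Fin N, ∑ m : Fin (M (P j)), g' ⟨j, m⟩ (‖x‖ ^ 2) * MvPolynomial.eval (fun i => x i) (H' ⟨j, m⟩) :=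
    Fintype.sum_sigma (fun km : ι => g' km (‖x‖ ^ 2) * MvPolynomial.eval (fun i => x i) (H' km))
  rw [hsig]
  refine Finset.sum_congr rfl fun j _ => ?_
  have hPj := hP (P j)
  calc g j (‖x‖ ^ 2) * MvPolynomial.eval (fun i => x i) (P j)
      = g j (‖x‖ ^ 2) * MvPolynomial.eval (fun i => x i) (∑ m, r2poly ^ (e (P j) m) * H (P j) m) := by
        rw [← hPj]
    _ = ∑ m : Fin (M (P j)), g' ⟨j, m⟩ (‖x‖ ^ 2) * MvPolynomial.eval (fun i => x i) (H' ⟨j, m⟩) := by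
        rw [map_sum, Finset.mul_sum]
        refine Finset.sum_congr rfl fun m _ => ?_
        simp only [g', H', map_mul, map_pow, eval_r2poly]
        ring
/-! ### v1 sharp forms (documentary; NOT registered): the two-channel / sextic-exclusion pair -/

/-- v1-T1 «TWO-CHANNEL FORM» (sharp form of `FiniteType`: only the channels of degree 0 and 6 occur). Implies `FiniteType`
(`finiteType_of_twoChannel`). -/
def TwoChannel : Prop :=
  ∀ K : E4 → ℝ, InClass K →
    ∃ g h : ℝ → ℝ, ∀ x : E4, x ≠ 0 → K x = g (‖x‖ ^ 2) + h (‖x‖ ^ 2) * H6 x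

/-- v1-T2 «SEXTIC CHANNEL EXCLUSION» (the channel-set-{0,6} case of `FiniteTypeRigidity`). -/
def SexticExclusion : Prop :=
  ∀ K : E4 → ℝ, InClass K → ∀ g h : ℝ → ℝ,
    (∀ x : E4, x ≠ 0 → K x = g (‖x‖ ^ 2) + h (‖x‖ ^ 2) * H6 x) →
    ∀ x : E4, x ≠ 0 → K x = g (‖x‖ ^ 2)

/-- `H6` as a polynomial in the coordinates. -/
noncomputable def H6poly : MvPolynomial (Fin 4) ℝ :=
  let u : Fin 4 → MvPolynomial (Fin 4) ℝ := fun i => MvPolynomial.X i ^ 2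
  5 * (u 0 ^ 2 * (u 1 + u 2 + u 3) + u 1 ^ 2 * (u 0 + u 2 + u 3) + u 2 ^ 2 * (u 0 + u 1 + u 3)
        + u 3 ^ 2 * (u 0 + u 1 + u 2))
    - (u 0 ^ 3 + u 1 ^ 3 + u 2 ^ 3 + u 3 ^ 3)
    - 30 * (u 0 * u 1 * u 2 + u 0 * u 1 * u 3 + u 0 * u 2 * u 3 + u 1 * u 2 * u 3)

theorem eval_H6poly (x : E4) : MvPolynomial.eval (fun i => x i) H6poly = H6 x := by
  simp [H6poly, H6, H6sq, map_sub, map_mul, map_add, map_pow]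

/-- The sharp form implies the registered one: two channels are finitely many. -/
theorem finiteType_of_twoChannel (h : TwoChannel) : FiniteType := by
  intro K hK
  obtain ⟨g, h6, hgh⟩ := h K hK
  refine ⟨2, ![1, H6poly], ![g, h6], fun x hx => ?_⟩
  rw [hgh x hx, Fin.sum_univ_two]
  simp [eval_H6poly]

/-! ## Kernel-checked composition: (A, T1'') → T1' → (with T2') C3 → ⟨23125⟩ BY NAME -/

/-- T1' and T2' give C3 `GlobalShortRootRigidity` (spelled out exactly as in the tree certificate). -/
theorem globalRigidity_of_channels (h1 : FiniteType) (h2 : FiniteTypeRigidity) :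
    ∀ K : EuclideanSpace ℝ (Fin 4) → ℝ,
      ContinuousOn K {x | x ≠ 0} →
      (∃ C : ℝ, ∀ x, 1 ≤ ‖x‖ → |K x| ≤ C) →
      (∀ R : EuclideanSpace ℝ (Fin 4) ≃ₗᵢ[ℝ] EuclideanSpace ℝ (Fin 4), IsSignedPerm R → ∀ x, K (R x) = K x) →
      (∀ (m : ℕ) (x : Fin m → EuclideanSpace ℝ (Fin 4)) (c : Fin m → ℝ), (∀ i, 0 < x i 0) →
          0 ≤ ∑ i, ∑ j, c i * c j * K (timeReflection 4 (x i) - x j)) →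
      Tendsto (fun x : EuclideanSpace ℝ (Fin 4) => ‖x‖ ^ 8 * K x) (𝓝[≠] 0) (𝓝 0) →
      (∀ R : EuclideanSpace ℝ (Fin 4) ≃ₗᵢ[ℝ] EuclideanSpace ℝ (Fin 4),
          (∀ z : Fin 4 → ℤ, Even (∑ i, z i) → ∃ w : Fin 4 → ℤ, Even (∑ i, w i) ∧ R (siteToE z) = siteToE w) →
          ∀ x, K (R x) = K x) →
      ∀ (R : EuclideanSpace ℝ (Fin 4) ≃ₗᵢ[ℝ] EuclideanSpace ℝ (Fin 4)) (x : EuclideanSpace ℝ (Fin 4)),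
        K (R x) = K x := by
  intro K hK hbd hB hRP hbud hlat R x
  have hcls : InClass K := ⟨hK, hbd, hB, hRP, hbud, hlat⟩
  obtain ⟨N, P, g, hrep⟩ := h1 K hcls
  obtain ⟨g₀, hrad⟩ := h2 K hcls N P g hrep
  by_cases hx : x = 0
  · subst hx; simp
  · have hRx : R x ≠ 0 := by
      intro h0
      apply hx
      have hn : ‖R x‖ = 0 := by rw [h0, norm_zero]
      rw [LinearIsometryEquiv.norm_map] at hn
      exact norm_eq_zero.mp hn
    rw [hrad (R x) hRx, hrad x hx, LinearIsometryEquiv.norm_map]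

/-- **SKELETON THEOREM (v4)**: the served leaf ⟨stmt-QuantumFields-23125⟩ `RationalToGeneral` BY NAME, from the four
registered stubs (`stub_analyticFiniteType`, `stub_laplaceFourier`, `stub_fischerNormalForm`, `stub_topChannelCone`), the tree
theorem `mirrorAnalyticity_holds`, the proved reductions `finiteType_of`, `finiteTypeRigidity_of`, `globalRigidity_of_channels`, and
the tree certificate `rationalToGeneral_of_global` (LINE g16-A, p682986). -/
theorem RationalToGeneral_of_channels : RationalToGeneral :=
  rationalToGeneral_of_global
    (globalRigidity_of_channels (finiteType_of mirrorAnalyticity_holds stub_analyticFiniteType)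
      (finiteTypeRigidity_of stub_fischerNormalForm stub_laplaceFourier topChannelCone_holds))

end Summit.QuantumFields.YangMills.Cruxes.RationalToGeneral.SexticChannel
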